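import Mathlib
import Summits.Ventures.PercRepro2.EightTypedOrbit
import Summits.Ventures.PercRepro2.SevenTypedSum
import Summits.Ventures.PercRepro2.TwoTypedBridge
import Summits.Ventures.PercRepro2.TypedSplit

/-!
# Eight typed edges, VII: the typed count is a placement sum (blind cell PercRepro2, night-3 g10, 2026-08-26)

The generic bridge (no type-vector case analysis): `typedCount_oct` splits the count over eight typed edges
edge by edge (`typedCount_split`), the served `sum_Tk7` turns each edge's three-bit sum with its open-count
condition into the list `Tk7 (τ e)`, and **`typedCount_oct_eq_psum`**: `typedCount {e₁, …, e₈} z τ K₃ =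
psum S (pl8 τ)` for a state assignment `S` with `S (mk8 c₁ … c₈) = st (z₀ + A)` (`A` the edges selected by the
bits) — `SevenTypedSum.lean` one rung up.
-/

namespace Summit.Ventures.PercRepro2

open UnionCluster

namespace CovForm

namespace TwoTyped

open OneTyped TypedRed

section Sum8

variable {E : Type*} [Fintype E] [DecidableEq E] {R : Type*} [Field R]

set_option maxHeartbeats 8000000 in
/-- **Eight typed edges**: the typed count over `F = {e₁, …, e₈}` split edge by edge. -/
theorem typedCount_oct (z : Config E) (e1 e2 e3 e4 e5 e6 e7 e8 : E) (h12 : e1 ≠ e2) (h13 : e1 ≠ e3) (h14 : e1 ≠ e4) (h15 : e1 ≠ e5) (h16 : e1 ≠ e6) (h17 : e1 ≠ e7) (h18 : e1 ≠ e8) (h23 : e2 ≠ e3) (h24 : e2 ≠ e4) (h25 : e2 ≠ e5) (h26 : e2 ≠ e6) (h27 : e2 ≠ e7) (h28 : e2 ≠ e8) (h34 : e3 ≠ e4) (h35 : e3 ≠ e5) (h36 : e3 ≠ e6) (h37 : e3 ≠ e7) (h38 : e3 ≠ e8) (h45 : e4 ≠ e5) (h46 : e4 ≠ e6) (h47 :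 e4 ≠ e7) (h48 : e4 ≠ e8) (h56 : e5 ≠ e6) (h57 : e5 ≠ e7) (h58 : e5 ≠ e8) (h67 : e6 ≠ e7) (h68 : e6 ≠ e8) (h78 : e7 ≠ e8)
    (τ : E → ℕ) (K : Config E → Config E → Config E → R) :
    typedCount {e1, e2, e3, e4, e5, e6, e7, e8} z τ K =
      ∑ a1 : Bool, ∑ b1 : Bool, ∑ c1 : Bool, if a1.toNat + b1.toNat + c1.toNat = τ e1 then
      ∑ a2 : Bool, ∑ b2 : Bool, ∑ c2 : Bool, if a2.toNat + b2.toNat + c2.toNat = τ e2 then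
      ∑ a3 : Bool, ∑ b3 : Bool, ∑ c3 : Bool, if a3.toNat + b3.toNat + c3.toNat = τ e3 then
      ∑ a4 : Bool, ∑ b4 : Bool, ∑ c4 : Bool, if a4.toNat + b4.toNat + c4.toNat = τ e4 then
      ∑ a5 : Bool, ∑ b5 : Bool, ∑ c5 : Bool, if a5.toNat + b5.toNat + c5.toNat = τ e5 then
      ∑ a6 : Bool, ∑ b6 : Bool, ∑ c6 : Bool, if a6.toNat + b6.toNat + c6.toNat = τ e6 then
      ∑ a7 : Bool, ∑ b7 : Bool, ∑ c7 : Bool, if a7.toNat + b7.toNat + c7.toNat = τ e7 then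
      ∑ a8 : Bool, ∑ b8 : Bool, ∑ c8 : Bool, if a8.toNat + b8.toNat + c8.toNat = τ e8 then
        K (Function.update (Function.update (Function.update (Function.update (Function.update (Function.update (Function.update (Function.update (Function.update (Function.update (Function.update (Function.update (Function.update (Function.update (Function.update (Function.update z e1 false) e2 false) e3 false) e4 false) e5 false) e6 false) e7 false) e8 false) e8 a8) e7 a7) e6 a6) e5 a5) e4 a4) e3 a3) e2 a2) e1 a1)
          (Function.update (Function.update (Function.update (Function.update (Function.update (Function.update (Function.update (Function.update (Function.update (Function.update (Function.update (Function.update (Function.update (Function.update (Function.update (Function.update z e1 false) e2 false) e3 false) e4 false) e5 false) e6 false) e7 false) e8 false) e8 b8) e7 b7) e6 b6) e5 b5) e4 b4) e3 b3) e2 b2) e1 b1)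
          (Function.update (Function.update (Function.update (Function.update (Function.update (Function.update (Function.update (Function.update (Function.update (Function.update (Function.update (Function.update (Function.update (Function.update (Function.update (Function.update z e1 false) e2 false) e3 false) e4 false) e5 false) e6 false) e7 false) e8 false) e8 c8) e7 c7) e6 c6) e5 c5) e4 c4) e3 c3) e2 c2) e1 c1)
      else 0 else 0 else 0 else 0 else 0 else 0 else 0 else 0 := by
  have m1 : e1 ∈ ({e1, e2, e3, e4, e5, e6, e7, e8} : Finset E) := by simp
  have r1 : ({e1, e2, e3, e4, e5, e6, e7, e8} : Finset E).erase e1 = {e2, e3, e4, e5, e6, e7, e8} := by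
    rw [Finset.erase_insert (by simp [h12, h13, h14, h15, h16, h17, h18])]
  have m2 : e2 ∈ ({e2, e3, e4, e5, e6, e7, e8} : Finset E) := by simp
  have r2 : ({e2, e3, e4, e5, e6, e7, e8} : Finset E).erase e2 = {e3, e4, e5, e6, e7, e8} := by
    rw [Finset.erase_insert (by simp [h23, h24, h25, h26, h27, h28])]
  have m3 : e3 ∈ ({e3, e4, e5, e6, e7, e8} : Finset E) := by simp
  have r3 : ({e3, e4, e5, e6, e7, e8} : Finset E).erase e3 = {e4, e5, e6, e7, e8} := by
    rw [Finset.erase_insert (by simp [h34, h35, h36, h37, h38])]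
  have m4 : e4 ∈ ({e4, e5, e6, e7, e8} : Finset E) := by simp
  have r4 : ({e4, e5, e6, e7, e8} : Finset E).erase e4 = {e5, e6, e7, e8} := by
    rw [Finset.erase_insert (by simp [h45, h46, h47, h48])]
  have m5 : e5 ∈ ({e5, e6, e7, e8} : Finset E) := by simp
  have r5 : ({e5, e6, e7, e8} : Finset E).erase e5 = {e6, e7, e8} := by
    rw [Finset.erase_insert (by simp [h56, h57, h58])]
  have m6 : e6 ∈ ({e6, e7, e8} : Finset E) := by simp
  have r6 : ({e6, e7, e8} : Finset E).erase e6 = {e7, e8} := by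
    rw [Finset.erase_insert (by simp [h67, h68])]
  have m7 : e7 ∈ ({e7, e8} : Finset E) := by simp
  have r7 : ({e7, e8} : Finset E).erase e7 = {e8} := by
    rw [Finset.erase_insert (by simp [h78])]
  have m8 : e8 ∈ ({e8} : Finset E) := by simp
  have r8 : ({e8} : Finset E).erase e8 = ∅ := Finset.erase_singleton e8
  rw [TypedRed.typedCount_split _ e1 m1]
  refine Finset.sum_congr rfl fun a1 _ => Finset.sum_congr rfl fun b1 _ =>
    Finset.sum_congr rfl fun c1 _ => ?_
  by_cases hc1 : a1.toNat + b1.toNat + c1.toNat = τ e1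
  swap
  · rw [if_neg hc1, if_neg hc1]
  rw [if_pos hc1, if_pos hc1, r1, TypedRed.typedCount_split _ e2 m2]
  refine Finset.sum_congr rfl fun a2 _ => Finset.sum_congr rfl fun b2 _ =>
    Finset.sum_congr rfl fun c2 _ => ?_
  by_cases hc2 : a2.toNat + b2.toNat + c2.toNat = τ e2
  swap
  · rw [if_neg hc2, if_neg hc2]
  rw [if_pos hc2, if_pos hc2, r2, TypedRed.typedCount_split _ e3 m3]
  refine Finset.sum_congr rfl fun a3 _ => Finset.sum_congr rfl fun b3 _ =>
    Finset.sum_congr rfl fun c3 _ => ?_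
  by_cases hc3 : a3.toNat + b3.toNat + c3.toNat = τ e3
  swap
  · rw [if_neg hc3, if_neg hc3]
  rw [if_pos hc3, if_pos hc3, r3, TypedRed.typedCount_split _ e4 m4]
  refine Finset.sum_congr rfl fun a4 _ => Finset.sum_congr rfl fun b4 _ =>
    Finset.sum_congr rfl fun c4 _ => ?_
  by_cases hc4 : a4.toNat + b4.toNat + c4.toNat = τ e4
  swap
  · rw [if_neg hc4, if_neg hc4]
  rw [if_pos hc4, if_pos hc4, r4, TypedRed.typedCount_split _ e5 m5]
  refine Finset.sum_congr rfl fun a5 _ => Finset.sum_congr rfl fun b5 _ =>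
    Finset.sum_congr rfl fun c5 _ => ?_
  by_cases hc5 : a5.toNat + b5.toNat + c5.toNat = τ e5
  swap
  · rw [if_neg hc5, if_neg hc5]
  rw [if_pos hc5, if_pos hc5, r5, TypedRed.typedCount_split _ e6 m6]
  refine Finset.sum_congr rfl fun a6 _ => Finset.sum_congr rfl fun b6 _ =>
    Finset.sum_congr rfl fun c6 _ => ?_
  by_cases hc6 : a6.toNat + b6.toNat + c6.toNat = τ e6
  swap
  · rw [if_neg hc6, if_neg hc6]
  rw [if_pos hc6, if_pos hc6, r6, TypedRed.typedCount_split _ e7 m7]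
  refine Finset.sum_congr rfl fun a7 _ => Finset.sum_congr rfl fun b7 _ =>
    Finset.sum_congr rfl fun c7 _ => ?_
  by_cases hc7 : a7.toNat + b7.toNat + c7.toNat = τ e7
  swap
  · rw [if_neg hc7, if_neg hc7]
  rw [if_pos hc7, if_pos hc7, r7, TypedRed.typedCount_split _ e8 m8]
  refine Finset.sum_congr rfl fun a8 _ => Finset.sum_congr rfl fun b8 _ =>
    Finset.sum_congr rfl fun c8 _ => ?_
  by_cases hc8 : a8.toNat + b8.toNat + c8.toNat = τ e8
  swap
  · rw [if_neg hc8, if_neg hc8]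
  rw [if_pos hc8, if_pos hc8, r8, typedCount_empty]

end Sum8

section Bridge8

open Classical

variable {V : Type*} {E : Type*} [Fintype E] [DecidableEq E] {R : Type*} [Field R]
variable (ends : E → Sym2 V) (o a₁ a₂ a₃ b : V)

set_option maxHeartbeats 32000000 in
set_option maxRecDepth 100000 in
/-- **The typed count over eight typed edges is the placement sum of `K₃` on the states of its merge
cube** — for a state assignment `S` with `S (mk8 c₁ … c₈) = st (z₀ + {edges selected by the bits})`. -/
theorem typedCount_oct_eq_psum (z : Config E) (e1 e2 e3 e4 e5 e6 e7 e8 : E) (h12 : e1 ≠ e2) (h13 : e1 ≠ e3) (h14 : e1 ≠ e4) (h15 : e1 ≠ e5) (h16 : e1 ≠ e6) (h17 : e1 ≠ e7) (h18 : e1 ≠ e8) (h23 : e2 ≠ e3) (h24 : e2 ≠ e4) (h25 : e2 ≠ e5) (h26 : e2 ≠ e6) (h27 : e2 ≠ e7) (h28 : e2 ≠ e8) (h34 : e3 ≠ e4) (h35 : e3 ≠ e5) (h36 : e3 ≠ e6) (h37 : e3 ≠ e7) (h38 : e3 ≠ e8) (h45 : e4 ≠ e5) (h46 : e4 ≠ e6)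 (h47 : e4 ≠ e7) (h48 : e4 ≠ e8) (h56 : e5 ≠ e6) (h57 : e5 ≠ e7) (h58 : e5 ≠ e8) (h67 : e6 ≠ e7) (h68 : e6 ≠ e8) (h78 : e7 ≠ e8)
    (τ : E → ℕ) (h1 : τ e1 = 1 ∨ τ e1 = 2) (h2 : τ e2 = 1 ∨ τ e2 = 2) (h3 : τ e3 = 1 ∨ τ e3 = 2) (h4 : τ e4 = 1 ∨ τ e4 = 2) (h5 : τ e5 = 1 ∨ τ e5 = 2) (h6 : τ e6 = 1 ∨ τ e6 = 2) (h7 : τ e7 = 1 ∨ τ e7 = 2) (h8 : τ e8 = 1 ∨ τ e8 = 2)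
    (S : ℕ → St) (hS : ∀ (c1 c2 c3 c4 c5 c6 c7 c8 : Bool), st ends o a₁ a₂ a₃ b (Function.update (Function.update (Function.update (Function.update (Function.update (Function.update (Function.update (Function.update (Function.update (Function.update (Function.update (Function.update (Function.update (Function.update (Function.update (Function.update z e1 false) e2 false) e3 false) e4 false) e5 false) e6 false) e7 false) e8 false) e8 c8) e7 c7) e6 c6) e5 c5) e4 c4) e3 c3) e2 c2) e1 c1) = S (mk8 c1 c2 c3 c4 c5 c6 c7 c8)) :
    typedCount {e1, e2, e3, e4, e5, e6, e7, e8} z τ (K3 ends o a₁ a₂ a₃ b : Config E → Config E → Config E → R) =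
      ((psum S (pl8 (τ e1) (τ e2) (τ e3) (τ e4) (τ e5) (τ e6) (τ e7) (τ e8)) : ℤ) : R) := by
  rw [typedCount_oct z e1 e2 e3 e4 e5 e6 e7 e8 h12 h13 h14 h15 h16 h17 h18 h23 h24 h25 h26 h27 h28 h34 h35 h36 h37 h38 h45 h46 h47 h48 h56 h57 h58 h67 h68 h78 τ]
  simp only [sum_Tk7 (τ e1) h1, sum_Tk7 (τ e2) h2, sum_Tk7 (τ e3) h3, sum_Tk7 (τ e4) h4, sum_Tk7 (τ e5) h5, sum_Tk7 (τ e6) h6, sum_Tk7 (τ e7) h7, sum_Tk7 (τ e8) h8]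
  simp only [K3_eq_KB ends o a₁ a₂ a₃ b, hS]
  simp only [pl8, psum_flatMap7, psum_map7, Int.cast_list_sum, List.map_map, Function.comp_def]

end Bridge8

end TwoTyped

end CovForm

end Summit.Ventures.PercRepro2
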